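import Summits.Ventures.PercRepro.C041TriDomK4
import Summits.Ventures.PercRepro.C041ZoneOneVertexDefs

/-!
# ROW C-041 — THEOREM (TWO-EXIT TYPES): the block map of ANY two-exit host by the status types of its colourings,
and the complementation identities between the type counts (p6, gen 39; P6-TWOEXIT-LEAN.md §51)

For a finite host `Z₁` with anchor `a₁` and exits `u`, `u′` (`C041MultiExitTwo`: `blockMap Z₁ (ex2 u u′) a₁ w = Σ_ω
contrib (w false) (w true) (Mg a₁ u ω) (Rd a₁ u ω) (Mg a₁ u′ ω) (Rd a₁ u′ ω) (Mg u u′ ω)`), the STATUS TYPE of a colouring is the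
six Booleans `styp ω = (merged u, reached u, merged u′, reached u′, blue-connected exits, red-connected exits)`, its TYPE
COUNT `tcount t = #{ω | styp ω = t}`, and its ATOM `tatom w w′ t = contrib w w′ …` at the first five Booleans.  THE FIBRE
DECOMPOSITION (`blockMap_ex2_eq_sum_types`): `blockMap = Σ_t tcount t • tatom (w false) (w true) t` — every two-exit
block map is a non-negative integer combination of the ten status atoms (`θ_B θ_B′`, `θ_B w′`, `w θ_B′`, `w w′`, `θ_R w′`,
`w θ_R′`, `θ_R(w w′)`, `θ_R θ_R′`, `θ_R θ_B′`, `θ_B θ_R′`, and the `W`-atoms through `θ_B ∘ θ_R = n·1`).  THE COMPLEMENTATION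
(`tcount_tswap`): the involution `cpl ω = !ω` exchanges merged and reached (`Mg_cpl`, `Rd_cpl`), so `tcount (tswap t) =
tcount t` with `tswap (m, r, m′, r′, b, c) = (r, m, r′, m′, c, b)`; with the structural facts «both merged ⟹ blue-connected»,
«both reached ⟹ red-connected», «one merged and one separated ⟹ not blue-connected» (and the red mirrors) this gives the
identities `N_BB = N_RRj + N_RRa`, `N_BX = N_RX`, `N_XB = N_XR`, `N_RB = N_BR` of §51 (`tcount_BB`, `tcount_RX`, `tcount_XR`,
`tcount_BR`).  THE DOMINATION CRITERION (`blockMap_ex2_eq_dom`): if no colouring leaves an exit neither merged nor reached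
(`NoW`), and the counts satisfy `N_RRa = c + N_RB`, `N_RRj = c + s₁`, `N_BX = c + s₂`, `N_XB = c + s₃`, then
`blockMap = c • θ_△ + N_RB • ℓψ(w)ℓψ(w′) + s₁ • ℓψ(w w′) + s₂ • ℓψ(w) w′ + s₃ • w ℓψ(w′) + N_XX • w w′` — hence (P) and the ZONE
O-CUBE at the host with two cone zones (`K4v_blockMap_ex2_of_dom`, `zoneOCube_blockMap_ex2_of_dom`) and the host is a cone
host as soon as the triangle is (`coneHost_ex2_of_dom`).  `K₄` (`C041TriDomK4`) and the 17 five-vertex cores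
(`C041TriDomCores5A–D`) are instances; the diamonds and the other 18 five-vertex cores fail the count condition.
-/

namespace PercRepro

namespace ZoneZ

namespace MultiExit

open ZoneData Pendant Finset TwoExit TreeClosure RelaxedTriangle

variable {V₁ E₁ U₁ U₂ : Type} (Z₁ : ZoneData V₁ E₁ U₁ U₂) (u u' a₁ : V₁)

/-- The status types: `(merged u, reached u, merged u′, reached u′, blue-connected exits, red-connected exits)`. -/
abbrev Typ := Bool × Bool × Bool × Bool × Bool × Bool

open Classical in
/-- The status type of a colouring. -/
noncomputable def styp (ω : E₁ → Bool) : Typ :=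
  (decide (Z₁.Mg a₁ u ω), decide (Z₁.Rd a₁ u ω), decide (Z₁.Mg a₁ u' ω), decide (Z₁.Rd a₁ u' ω),
    decide (Z₁.Mg u u' ω), decide (Z₁.Rd u u' ω))

/-- The atom of a type: the two-exit contribution at its first five statuses. -/
noncomputable def tatom (w w' : Vec6) (t : Typ) : Vec6 :=
  contrib w w' (t.1 = true) (t.2.1 = true) (t.2.2.1 = true) (t.2.2.2.1 = true) (t.2.2.2.2.1 = true)

/-- The atom of the type of a colouring is its contribution. -/
theorem tatom_styp (w w' : Vec6) (ω : E₁ → Bool) :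
    tatom w w' (styp Z₁ u u' a₁ ω) =
      contrib w w' (Z₁.Mg a₁ u ω) (Z₁.Rd a₁ u ω) (Z₁.Mg a₁ u' ω) (Z₁.Rd a₁ u' ω) (Z₁.Mg u u' ω) := by
  simp only [tatom, styp, decide_eq_true_eq]

/-! ## Structural facts on the statuses -/

/-- Two reached exits are red-connected. -/
theorem Rd_exits_of_reached (ω : E₁ → Bool) (h : Z₁.Rd a₁ u ω) (h' : Z₁.Rd a₁ u' ω) : Z₁.Rd u u' ω :=
  (ZoneData.Mg_cpl Z₁ u u' ω).1 (Mg_exits_of_merged Z₁ u u' a₁ (ZoneData.cpl ω) ((ZoneData.Mg_cpl Z₁ a₁ u ω).2 h) ((ZoneData.Mg_cpl Z₁ a₁ u' ω).2 h'))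

/-- A separated and a merged exit are not blue-connected. -/
theorem not_Mg_exits_of_sep_merged (ω : E₁ → Bool) (h : ¬ Z₁.Mg a₁ u ω) (h' : Z₁.Mg a₁ u' ω) : ¬ Z₁.Mg u u' ω :=
  fun hc => not_Mg_exits_of_merged_sep Z₁ u' u a₁ ω h' h (Mg_symm Z₁ ω u u' hc)

/-- A reached and an unreached exit are not red-connected. -/
theorem not_Rd_exits_of_reached_unreached (ω : E₁ → Bool) (h : Z₁.Rd a₁ u ω) (h' : ¬ Z₁.Rd a₁ u' ω) :
    ¬ Z₁.Rd u u' ω :=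
  fun hc => not_Mg_exits_of_merged_sep Z₁ u u' a₁ (ZoneData.cpl ω) ((ZoneData.Mg_cpl Z₁ a₁ u ω).2 h)
    (fun hm => h' ((ZoneData.Mg_cpl Z₁ a₁ u' ω).1 hm)) ((ZoneData.Mg_cpl Z₁ u u' ω).2 hc)

/-- An unreached and a reached exit are not red-connected. -/
theorem not_Rd_exits_of_unreached_reached (ω : E₁ → Bool) (h : ¬ Z₁.Rd a₁ u ω) (h' : Z₁.Rd a₁ u' ω) :
    ¬ Z₁.Rd u u' ω :=
  fun hc => not_Mg_exits_of_sep_merged Z₁ u u' a₁ (ZoneData.cpl ω) (fun hm => h ((ZoneData.Mg_cpl Z₁ a₁ u ω).1 hm))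
    ((ZoneData.Mg_cpl Z₁ a₁ u' ω).2 h') ((ZoneData.Mg_cpl Z₁ u u' ω).2 hc)

/-- The IMPOSSIBLE types: both merged but not blue-connected, both reached but not red-connected, one merged and
one separated but blue-connected, one reached and one unreached but red-connected. -/
def Impossible (t : Typ) : Prop :=
  (t.1 = true ∧ t.2.2.1 = true ∧ t.2.2.2.2.1 = false) ∨ (t.2.1 = true ∧ t.2.2.2.1 = true ∧ t.2.2.2.2.2 = false) ∨
  (t.1 = true ∧ t.2.2.1 = false ∧ t.2.2.2.2.1 = true) ∨ (t.1 = false ∧ t.2.2.1 = true ∧ t.2.2.2.2.1 = true) ∨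
  (t.2.1 = true ∧ t.2.2.2.1 = false ∧ t.2.2.2.2.2 = true) ∨ (t.2.1 = false ∧ t.2.2.2.1 = true ∧ t.2.2.2.2.2 = true)

/-- `Impossible` is decidable (a Boolean formula on the six statuses). -/
instance (t : Typ) : Decidable (Impossible t) := by unfold Impossible; infer_instance

/-- No colouring has an impossible type. -/
theorem styp_not_impossible (ω : E₁ → Bool) : ¬ Impossible (styp Z₁ u u' a₁ ω) := by
  classical
  simp only [Impossible, styp, decide_eq_true_eq, decide_eq_false_iff_not]
  rintro (⟨h1, h2, h3⟩ | ⟨h1, h2, h3⟩ | ⟨h1, h2, h3⟩ | ⟨h1, h2, h3⟩ | ⟨h1, h2, h3⟩ | ⟨h1, h2, h3⟩)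
  · exact h3 (Mg_exits_of_merged Z₁ u u' a₁ ω h1 h2)
  · exact h3 (Rd_exits_of_reached Z₁ u u' a₁ ω h1 h2)
  · exact not_Mg_exits_of_merged_sep Z₁ u u' a₁ ω h1 h2 h3
  · exact not_Mg_exits_of_sep_merged Z₁ u u' a₁ ω h1 h2 h3
  · exact not_Rd_exits_of_reached_unreached Z₁ u u' a₁ ω h1 h2 h3
  · exact not_Rd_exits_of_unreached_reached Z₁ u u' a₁ ω h1 h2 h3

/-! ## The complementation involution on the types -/

/-- Merged ↔ reached for both exits, blue-connected ↔ red-connected. -/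
def tswap (t : Typ) : Typ := (t.2.1, t.1, t.2.2.2.1, t.2.2.1, t.2.2.2.2.2, t.2.2.2.2.1)

/-- `tswap` is an involution. -/
theorem tswap_tswap (t : Typ) : tswap (tswap t) = t := rfl

/-- The type of the complemented colouring is the swapped type. -/
theorem styp_cpl (ω : E₁ → Bool) : styp Z₁ u u' a₁ (ZoneData.cpl ω) = tswap (styp Z₁ u u' a₁ ω) := by
  simp only [styp, tswap, Prod.mk.injEq, decide_eq_decide, ZoneData.Mg_cpl, ZoneData.Rd_cpl, iff_self, and_self]

variable [Fintype E₁] [DecidableEq E₁]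

open Classical in
/-- The number of colourings of a given status type. -/
noncomputable def tcount (t : Typ) : ℕ := (univ.filter fun ω : E₁ → Bool => styp Z₁ u u' a₁ ω = t).card

open Classical in
/-- **THE FIBRE DECOMPOSITION**: the two-exit block map is the sum over the status types of the type count times the atom. -/
theorem blockMap_ex2_eq_sum_types (w : Bool → Vec6) :
    blockMap Z₁ (ex2 u u') a₁ w = ∑ t : Typ, (tcount Z₁ u u' a₁ t : ℝ) • tatom (w false) (w true) t := by
  rw [blockMap_ex2]
  have h : ∀ ω : E₁ → Bool, contrib (w false) (w true) (Z₁.Mg a₁ u ω) (Z₁.Rd a₁ u ω) (Z₁.Mg a₁ u' ω)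
      (Z₁.Rd a₁ u' ω) (Z₁.Mg u u' ω) = tatom (w false) (w true) (styp Z₁ u u' a₁ ω) :=
    fun ω => (tatom_styp Z₁ u u' a₁ (w false) (w true) ω).symm
  simp_rw [h]
  rw [← Finset.sum_fiberwise univ (styp Z₁ u u' a₁)]
  refine Finset.sum_congr rfl fun t _ => ?_
  rw [Finset.sum_congr rfl (fun ω hω => by rw [(Finset.mem_filter.1 hω).2]), Finset.sum_const, tcount,
    Nat.cast_smul_eq_nsmul]

open Classical in
/-- **COMPLEMENTATION**: a type and its swap have the same number of colourings. -/
theorem tcount_tswap (t : Typ) : tcount Z₁ u u' a₁ (tswap t) = tcount Z₁ u u' a₁ t := by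
  unfold tcount
  refine Finset.card_bij' (fun ω _ => ZoneData.cpl ω) (fun ω _ => ZoneData.cpl ω) ?_ ?_ ?_ ?_
  · intro ω hω
    simp only [Finset.mem_filter, Finset.mem_univ, true_and] at hω ⊢
    rw [styp_cpl, hω, tswap_tswap]
  · intro ω hω
    simp only [Finset.mem_filter, Finset.mem_univ, true_and] at hω ⊢
    rw [styp_cpl, hω]
  · intro ω _
    exact ZoneData.cpl_cpl ω
  · intro ω _
    exact ZoneData.cpl_cpl ω

open Classical in
/-- An impossible type has no colourings. -/
theorem tcount_eq_zero_of_impossible (t : Typ) (ht : Impossible t) : tcount Z₁ u u' a₁ t = 0 := by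
  unfold tcount
  rw [Finset.card_eq_zero, Finset.filter_eq_empty_iff]
  intro ω _ hω
  exact styp_not_impossible Z₁ u u' a₁ ω (hω ▸ ht)


/-! ## THE DOMINATION CRITERION -/

/-- **No `W`-status**: no colouring leaves an exit neither merged nor reached (e.g. both exits adjacent to the anchor). -/
def NoW : Prop := ∀ ω : E₁ → Bool, (Z₁.Mg a₁ u ω ∨ Z₁.Rd a₁ u ω) ∧ (Z₁.Mg a₁ u' ω ∨ Z₁.Rd a₁ u' ω)

/-- A type with a `W` exit. -/
def HasW (t : Typ) : Prop := (t.1 = false ∧ t.2.1 = false) ∨ (t.2.2.1 = false ∧ t.2.2.2.1 = false)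

/-- `HasW` is decidable (a Boolean formula on the six statuses). -/
instance (t : Typ) : Decidable (HasW t) := by unfold HasW; infer_instance

open Classical in
/-- Under `NoW`, a type with a `W` exit has no colourings. -/
theorem tcount_eq_zero_of_hasW (hW : NoW Z₁ u u' a₁) (t : Typ) (ht : HasW t) : tcount Z₁ u u' a₁ t = 0 := by
  unfold tcount
  rw [Finset.card_eq_zero, Finset.filter_eq_empty_iff]
  intro ω _ hω
  subst hω
  have h := hW ω
  simp only [HasW, styp, decide_eq_false_iff_not] at ht
  rcases ht with ⟨h1, h2⟩ | ⟨h1, h2⟩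
  · exact h.1.elim h1 h2
  · exact h.2.elim h1 h2

/-- The eleven types a colouring can have when no exit is `W`: `BB` (red-connected exits or not), `BX`, `XB`, `XX`,
`RX`, `XR`, `RB`, `BR`, `RR` joint, `RR` apart. -/
def possTypes : Finset Typ :=
  {(true, false, true, false, true, false), (true, false, true, false, true, true), (true, false, true, true, true, false),
    (true, true, true, false, true, false), (true, true, true, true, true, true), (false, true, true, true, false, true),
    (true, true, false, true, false, true), (false, true, true, false, false, false), (true, false, false, true, false, false),
    (false, true, false, true, true, true), (false, true, false, true, false, true)}

/-- The Boolean check of the eleven types over all 64 (kernel `decide`). -/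
theorem chkTyp_all : ∀ t : Typ, (decide (Impossible t) || decide (HasW t) || decide (t ∈ possTypes)) = true := by
  decide

/-- Every type is impossible, has a `W` exit, or is one of the eleven. -/
theorem impossible_or_hasW_or_mem (t : Typ) : Impossible t ∨ HasW t ∨ t ∈ possTypes := by
  have h := chkTyp_all t
  simp only [Bool.or_eq_true, decide_eq_true_eq] at h
  rcases h with (h | h) | h
  · exact Or.inl h
  · exact Or.inr (Or.inl h)
  · exact Or.inr (Or.inr h)

open Classical in
/-- Under `NoW` the sum over all types is the sum over the eleven possible types. -/
theorem sum_types_eq_possTypes (hW : NoW Z₁ u u' a₁) (F : Typ → Vec6) :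
    ∑ t : Typ, (tcount Z₁ u u' a₁ t : ℝ) • F t = ∑ t ∈ possTypes, (tcount Z₁ u u' a₁ t : ℝ) • F t := by
  symm
  apply Finset.sum_subset (Finset.subset_univ _)
  intro t _ ht
  rcases impossible_or_hasW_or_mem t with h | h | h
  · rw [tcount_eq_zero_of_impossible Z₁ u u' a₁ t h]
    simp
  · rw [tcount_eq_zero_of_hasW Z₁ u u' a₁ hW t h]
    simp
  · exact absurd h ht

/-- `N_BB` with red-connected exits is `N_RRj`; `N_BB` without is `N_RRa`; `N_RX = N_BX`; `N_XR = N_XB`; `N_BR = N_RB`. -/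
theorem tcount_BB_true : tcount Z₁ u u' a₁ (true, false, true, false, true, true) =
    tcount Z₁ u u' a₁ (false, true, false, true, true, true) :=
  tcount_tswap Z₁ u u' a₁ (false, true, false, true, true, true)

/-- `N_BB` (exits not red-connected) is `N_RRa`. -/
theorem tcount_BB_false : tcount Z₁ u u' a₁ (true, false, true, false, true, false) =
    tcount Z₁ u u' a₁ (false, true, false, true, false, true) :=
  tcount_tswap Z₁ u u' a₁ (false, true, false, true, false, true)

/-- `N_RX = N_BX`. -/
theorem tcount_RX : tcount Z₁ u u' a₁ (false, true, true, true, false, true) =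
    tcount Z₁ u u' a₁ (true, false, true, true, true, false) :=
  tcount_tswap Z₁ u u' a₁ (true, false, true, true, true, false)

/-- `N_XR = N_XB`. -/
theorem tcount_XR : tcount Z₁ u u' a₁ (true, true, false, true, false, true) =
    tcount Z₁ u u' a₁ (true, true, true, false, true, false) :=
  tcount_tswap Z₁ u u' a₁ (true, true, true, false, true, false)

/-- `N_BR = N_RB`. -/
theorem tcount_BR : tcount Z₁ u u' a₁ (true, false, false, true, false, false) =
    tcount Z₁ u u' a₁ (false, true, true, false, false, false) :=
  tcount_tswap Z₁ u u' a₁ (false, true, true, false, false, false)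

/-- **THE DOMINATION CRITERION**: a two-exit host with no `W`-status whose counts satisfy `N_RRa = c + N_RB`,
`N_RRj = c + s₁`, `N_BX = c + s₂`, `N_XB = c + s₃` has block map `c·θ_△ + N_RB·ℓψ(w)ℓψ(w′) + s₁·ℓψ(w w′) + s₂·ℓψ(w) w′ +
s₃·w ℓψ(w′) + N_XX·w w′`. -/
theorem blockMap_ex2_eq_dom (hW : NoW Z₁ u u' a₁) (c s₁ s₂ s₃ : ℕ)
    (h1 : tcount Z₁ u u' a₁ (false, true, false, true, false, true) =
      c + tcount Z₁ u u' a₁ (false, true, true, false, false, false))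
    (h2 : tcount Z₁ u u' a₁ (false, true, false, true, true, true) = c + s₁)
    (h3 : tcount Z₁ u u' a₁ (true, false, true, true, true, false) = c + s₂)
    (h4 : tcount Z₁ u u' a₁ (true, true, true, false, true, false) = c + s₃) (w w' : Vec6) :
    blockMap Z₁ (ex2 u u') a₁ (fun b => if b then w' else w) =
      (c : ℝ) • thetaTri w w' + (tcount Z₁ u u' a₁ (false, true, true, false, false, false) : ℝ) • (ellv w * ellv w')
        + (s₁ : ℝ) • ellv (w * w') + (s₂ : ℝ) • (ellv w * w') + (s₃ : ℝ) • (w * ellv w')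
        + (tcount Z₁ u u' a₁ (true, true, true, true, true, true) : ℝ) • (w * w') := by
  rw [blockMap_ex2_eq_sum_types, sum_types_eq_possTypes Z₁ u u' a₁ hW]
  simp only [possTypes]
  rw [Finset.sum_insert (by decide), Finset.sum_insert (by decide), Finset.sum_insert (by decide),
    Finset.sum_insert (by decide), Finset.sum_insert (by decide), Finset.sum_insert (by decide),
    Finset.sum_insert (by decide), Finset.sum_insert (by decide), Finset.sum_insert (by decide),
    Finset.sum_insert (by decide), Finset.sum_singleton]
  rw [tcount_BB_true, tcount_BB_false, tcount_RX, tcount_XR, tcount_BR, h1, h2, h3, h4]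
  simp only [tatom, contrib, exitOf, if_true, if_false, Bool.false_eq_true]
  push_cast
  ext i
  simp only [thetaTri_eq_sum, Pi.add_apply, Pi.mul_apply, Pi.smul_apply, smul_eq_mul, thB, thR, ellv, ell, nAdm, kInv]
  fin_cases i <;> simp <;> ring

/-- **(P) AT A TRIANGLE-DOMINATED HOST WITH TWO CONE ZONES.** -/
theorem K4v_blockMap_ex2_of_dom (hW : NoW Z₁ u u' a₁) (c s₁ s₂ s₃ : ℕ)
    (h1 : tcount Z₁ u u' a₁ (false, true, false, true, false, true) =
      c + tcount Z₁ u u' a₁ (false, true, true, false, false, false))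
    (h2 : tcount Z₁ u u' a₁ (false, true, false, true, true, true) = c + s₁)
    (h3 : tcount Z₁ u u' a₁ (true, false, true, true, true, false) = c + s₂)
    (h4 : tcount Z₁ u u' a₁ (true, true, true, false, true, false) = c + s₃) {w w' : Vec6} (hw : InCone w)
    (hw' : InCone w') : K4v (blockMap Z₁ (ex2 u u') a₁ (fun b => if b then w' else w)) := by
  rw [blockMap_ex2_eq_dom Z₁ u u' a₁ hW c s₁ s₂ s₃ h1 h2 h3 h4]
  exact K4v_add (K4v_add (K4v_add (K4v_add (K4v_add
    (K4v_smul (K4v_thetaTri_of_InCone hw hw') (Nat.cast_nonneg c))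
    (K4v_smul (K4v_of_InCone ((inCone_ellv hw).mul (inCone_ellv hw'))) (Nat.cast_nonneg _)))
    (K4v_smul (K4v_of_InCone (inCone_ellv (hw.mul hw'))) (Nat.cast_nonneg s₁)))
    (K4v_smul (K4v_of_InCone ((inCone_ellv hw).mul hw')) (Nat.cast_nonneg s₂)))
    (K4v_smul (K4v_of_InCone (hw.mul (inCone_ellv hw'))) (Nat.cast_nonneg s₃)))
    (K4v_smul (K4v_of_InCone (hw.mul hw')) (Nat.cast_nonneg _))

/-- **A TRIANGLE-DOMINATED HOST IS A CONE HOST AS SOON AS THE TRIANGLE MAP IS A CONE MAP.** -/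
theorem coneHost_ex2_of_dom (hW : NoW Z₁ u u' a₁) (c s₁ s₂ s₃ : ℕ)
    (h1 : tcount Z₁ u u' a₁ (false, true, false, true, false, true) =
      c + tcount Z₁ u u' a₁ (false, true, true, false, false, false))
    (h2 : tcount Z₁ u u' a₁ (false, true, false, true, true, true) = c + s₁)
    (h3 : tcount Z₁ u u' a₁ (true, false, true, true, true, false) = c + s₂)
    (h4 : tcount Z₁ u u' a₁ (true, true, true, false, true, false) = c + s₃)
    (h : ∀ X Y : Vec6, InCone X → InCone Y → InCone (thetaTri X Y)) : ConeHost Z₁ (ex2 u u') a₁ := by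
  intro w hw
  rw [bool_family_eq w, blockMap_ex2_eq_dom Z₁ u u' a₁ hW c s₁ s₂ s₃ h1 h2 h3 h4]
  have hw0 := hw false
  have hw1 := hw true
  exact ((((((h _ _ hw0 hw1).smul _ (Nat.cast_nonneg c)).add
    (((inCone_ellv hw0).mul (inCone_ellv hw1)).smul _ (Nat.cast_nonneg _))).add
    ((inCone_ellv (hw0.mul hw1)).smul _ (Nat.cast_nonneg s₁))).add
    (((inCone_ellv hw0).mul hw1).smul _ (Nat.cast_nonneg s₂))).add
    ((hw0.mul (inCone_ellv hw1)).smul _ (Nat.cast_nonneg s₃))).add ((hw0.mul hw1).smul _ (Nat.cast_nonneg _))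


/-- The ZONE O-CUBE at a triangle-dominated host with two cone zones: `2F ≤ T₁ + T₂ + 2I`. -/
theorem zoneOCube_blockMap_ex2_of_dom (hW : NoW Z₁ u u' a₁) (c s₁ s₂ s₃ : ℕ)
    (h1 : tcount Z₁ u u' a₁ (false, true, false, true, false, true) =
      c + tcount Z₁ u u' a₁ (false, true, true, false, false, false))
    (h2 : tcount Z₁ u u' a₁ (false, true, false, true, true, true) = c + s₁)
    (h3 : tcount Z₁ u u' a₁ (true, false, true, true, true, false) = c + s₂)
    (h4 : tcount Z₁ u u' a₁ (true, true, true, false, true, false) = c + s₃) {w w' : Vec6} (hw : InCone w)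
    (hw' : InCone w') :
    0 ≤ (blockMap Z₁ (ex2 u u') a₁ (fun b => if b then w' else w) 1
          - blockMap Z₁ (ex2 u u') a₁ (fun b => if b then w' else w) 0)
        + (blockMap Z₁ (ex2 u u') a₁ (fun b => if b then w' else w) 2
          - blockMap Z₁ (ex2 u u') a₁ (fun b => if b then w' else w) 0)
        + 2 * (blockMap Z₁ (ex2 u u') a₁ (fun b => if b then w' else w) 4
          + blockMap Z₁ (ex2 u u') a₁ (fun b => if b then w' else w) 5
          - blockMap Z₁ (ex2 u u') a₁ (fun b => if b then w' else w) 3)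
        - 2 * blockMap Z₁ (ex2 u u') a₁ (fun b => if b then w' else w) 0 :=
  zoneOCube_nonneg_of_K4 (K4v_blockMap_ex2_of_dom Z₁ u u' a₁ hW c s₁ s₂ s₃ h1 h2 h3 h4 hw hw')

/-- The seed programme's target gives every triangle-dominated host: if `θ_△ (V a) (V b)` lies in the cone for all
pure inputs, the host is a cone host. -/
theorem coneHost_ex2_of_dom_pure (hW : NoW Z₁ u u' a₁) (c s₁ s₂ s₃ : ℕ)
    (h1 : tcount Z₁ u u' a₁ (false, true, false, true, false, true) =
      c + tcount Z₁ u u' a₁ (false, true, true, false, false, false))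
    (h2 : tcount Z₁ u u' a₁ (false, true, false, true, true, true) = c + s₁)
    (h3 : tcount Z₁ u u' a₁ (true, false, true, true, true, false) = c + s₂)
    (h4 : tcount Z₁ u u' a₁ (true, true, true, false, true, false) = c + s₃)
    (h : ∀ {m m' : ℕ} (a : Fin m → ℝ) (b : Fin m' → ℝ), (∀ i, 0 ≤ a i ∧ a i ≤ 1) → (∀ j, 0 ≤ b j ∧ b j ≤ 1) →
      InCone (thetaTri (V a) (V b))) : ConeHost Z₁ (ex2 u u') a₁ :=
  coneHost_ex2_of_dom Z₁ u u' a₁ hW c s₁ s₂ s₃ h1 h2 h3 h4 fun _ _ hX hY => InCone_thetaTri_of_pure h hX hY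

end MultiExit

end ZoneZ

end PercRepro
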